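import Literature.AnabelianGeometry.SemiGraphs.QuasiTemperoidsThmA4CechRelation
import HarnessLib

/-!
# Semi-graphs of anabelioids, Appendix, Theorem A.4 (Čech route): the Čech extension
# `ψ^*(X) := coeq(H((X ⨯ A) ⨯ A) ⇉ H(X ⨯ A))` PRESERVES FINITE LIMITS (part 2 of 2)

Mochizuki, *Semi-graphs of anabelioids*, Publ. RIMS **42** (2006) 221–322, Appendix, Theorem A.4
(manuscript pp. 82–86; the printed proof's clause "Thus, to show that `ψ` is a morphism of temperoids
[i.e., that `ψ^*` preserves finite limits], it suffices to show that `ψ^*` preserves terminal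
objects", p. 85, and the "routine argument" for fibre products) [cite: MochizukiSemiAnbd2006, Thm A.4 pp.82-86].
Row A4-∃ / file E3 (part 2) of `plan/L3/SUBDAG-SemiAnbd-Cor311.md` (holder abc-iut-w5-d129).  Over part 1
(`QuasiTemperoidsThmA4CechRelation.lean`: `CechSq.cechExt A H`, points of `ψ^*(X)` = points of
`H(X ⨯ A)` modulo the image equivalence relation), ON POINTS in `B^temp(Π₁)`:

* §4 `ψ^*` preserves the terminal object when `H(⊤ ⨯ A₂)` has a point (`(k₁, k₂)` is an
  isomorphism onto `P ⊤ ⨯ P ⊤`, so all points of `H(⊤ ⨯ A)` are related);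
* §5 `ψ^*` preserves pullbacks (surjectivity by the lifting square `K Y = P Y ×_{P Z, k₂} K Z`,
  injectivity by `K(X ×_Z Y) = K X ×_{K Z} K Y` and the joint injectivity of `(H k₁, H k₂)`);
* §6 **`CechSq.preservesFiniteLimits_cechExt`** — for every `H : T₂[A₂] ⥤ B^temp(Π₁)` preserving
  limits of cospan and binary-product shape with `H(⊤ ⨯ A₂)` nonempty (Mathlib: terminal object +
  pullbacks ⇒ all finite limits).

Nothing here takes a side on [IUTchIII] Cor. 3.12.
-/

open CategoryTheory CategoryTheory.Limits

noncomputable section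

namespace Literature.AnabelianGeometry.SemiGraphs

namespace CechSq

open WalkingParallelPair WalkingParallelPairHom

universe u

variable {G₁ : Type u} [Group G₁] [TopologicalSpace G₁] [IsTopologicalGroup G₁]
  {G₂ : Type u} [Group G₂] [TopologicalSpace G₂]
  [HasFiniteLimits (BTemp G₂)] [HasFiniteLimits (BTemp G₁)]
  [HasColimitsOfShape WalkingParallelPair (BTemp G₁)]
  (A : BTemp G₂) (H : Over' A ⥤ BTemp G₁)

/-! ### §4 `ψ^*` preserves the terminal object -/

section Terminal

variable [PreservesLimitsOfShape WalkingCospan H] [PreservesLimitsOfShape (Discrete WalkingPair) H]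

omit [IsTopologicalGroup G₁] [HasFiniteLimits (BTemp G₁)]
  [HasColimitsOfShape WalkingParallelPair (BTemp G₁)] [PreservesLimitsOfShape WalkingCospan H] in
/-- Over the terminal object ALL pairs of points of `H(⊤ ⨯ A)` are related (`(k₁, k₂)` is an
isomorphism onto `P ⊤ ⨯ P ⊤`, and `H` preserves that product). [cite: MochizukiSemiAnbd2006, Thm A.4 pp.82-86] -/
theorem pairRel_top (y y' : (H.obj (POver A (⊤_ BTemp G₂))).obj.V) :
    BTemp.PairRel (e₁ A H (⊤_ _)) (e₂ A H (⊤_ _)) y y' := by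
  have hfan := isLimitMapFan A H (fstOver A (⊤_ _)) (sndOver A (⊤_ _))
    (prodIsProd (P A (⊤_ BTemp G₂)) (P A (⊤_ BTemp G₂)))
  obtain ⟨q, hq₁, hq₂⟩ := BTemp.exists_point_of_isLimit_binaryFan' hfan y y'
  -- `(k₁, k₂)` is an isomorphism of `T₂[A₂]` over `⊤`
  haveI : IsIso ((admitsHomTo A).ι.map (liftOver A (⊤_ BTemp G₂))) :=
    isIso_lift_k₁_k₂_terminal (A := A)
  haveI : IsIso (liftOver A (⊤_ BTemp G₂)) := isIso_of_reflects_iso _ (admitsHomTo A).ι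
  refine ⟨(inv (H.map (liftOver A (⊤_ _)))).hom.hom q, ?_, ?_⟩
  · rw [← comp_apply']
    have : inv (H.map (liftOver A (⊤_ BTemp G₂))) ≫ e₁ A H (⊤_ _) = H.map (fstOver A (⊤_ _)) := by
      rw [IsIso.inv_comp_eq, ← H.map_comp]
      exact congrArg H.map (ObjectProperty.hom_ext _ (prod.lift_fst _ _)).symm
    rw [this]
    exact hq₁
  · rw [← comp_apply']
    have : inv (H.map (liftOver A (⊤_ BTemp G₂))) ≫ e₂ A H (⊤_ _) = H.map (sndOver A (⊤_ _)) := by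
      rw [IsIso.inv_comp_eq, ← H.map_comp]
      exact congrArg H.map (ObjectProperty.hom_ext _ (prod.lift_snd _ _)).symm
    rw [this]
    exact hq₂

omit [HasFiniteLimits (BTemp G₁)] in
/-- **`ψ^*(⊤)` is terminal** as soon as `H(⊤ ⨯ A)` has a point: it has exactly one point.
[cite: MochizukiSemiAnbd2006, Thm A.4 pp.82-86] -/
theorem nonempty_isTerminal_cechExt_top (hne : Nonempty (H.obj (POver A (⊤_ BTemp G₂))).obj.V) :
    Nonempty (IsTerminal ((cechExt A H).obj (⊤_ BTemp G₂))) :=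
  ⟨BTemp.isTerminal_of_unique _ ((π A H (⊤_ _)).hom.hom hne.some) fun t => by
    obtain ⟨y, rfl⟩ := π_surjective A H (⊤_ _) t
    exact (π_apply_eq_iff A H (⊤_ _)).mpr (pairRel_top A H y hne.some)⟩

/-- **`ψ^*` preserves the terminal object** (given a point of `H(⊤ ⨯ A)`).
[cite: MochizukiSemiAnbd2006, Thm A.4 pp.82-86] -/
theorem preservesLimit_empty (hne : Nonempty (H.obj (POver A (⊤_ BTemp G₂))).obj.V) :
    PreservesLimit (Functor.empty.{0} (BTemp G₂)) (cechExt A H) :=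
  preservesTerminal_of_iso (cechExt A H)
    ((nonempty_isTerminal_cechExt_top A H hne).some.uniqueUpToIso terminalIsTerminal)

end Terminal

/-! ### §5 `ψ^*` preserves pullbacks -/

section Pullback

variable [PreservesLimitsOfShape WalkingCospan H] [PreservesLimitsOfShape (Discrete WalkingPair) H]
  {X Y Z : BTemp G₂} (f : X ⟶ Z) (g : Y ⟶ Z)

omit [IsTopologicalGroup G₁] [HasFiniteLimits (BTemp G₁)]
  [HasColimitsOfShape WalkingParallelPair (BTemp G₁)] [PreservesLimitsOfShape (Discrete WalkingPair) H] in
omit [IsTopologicalGroup G₁] [HasFiniteLimits (BTemp G₁)]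
  [HasColimitsOfShape WalkingParallelPair (BTemp G₁)] [PreservesLimitsOfShape WalkingCospan H]
  [PreservesLimitsOfShape (Discrete WalkingPair) H] in
/-- The `P`-square over the pullback square commutes in `T₂[A₂]`. [cite: MochizukiSemiAnbd2006, Thm A.4 pp.82-86] -/
theorem commPOver :
    (ObjectProperty.homMk (mapP A (pullback.fst f g)) : POver A (pullback f g) ⟶ POver A X) ≫
        (ObjectProperty.homMk (mapP A f) : POver A X ⟶ POver A Z) =
      (ObjectProperty.homMk (mapP A (pullback.snd f g)) : POver A (pullback f g) ⟶ POver A Y) ≫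
        (ObjectProperty.homMk (mapP A g) : POver A Y ⟶ POver A Z) :=
  ObjectProperty.hom_ext _ (mapP_sq (A := A) (PullbackCone.mk (pullback.fst f g) (pullback.snd f g) pullback.condition))

omit [IsTopologicalGroup G₁] [HasFiniteLimits (BTemp G₁)]
  [HasColimitsOfShape WalkingParallelPair (BTemp G₁)] [PreservesLimitsOfShape WalkingCospan H]
  [PreservesLimitsOfShape (Discrete WalkingPair) H] in
/-- The `K`-square over the pullback square commutes in `T₂[A₂]`. [cite: MochizukiSemiAnbd2006, Thm A.4 pp.82-86] -/
theorem commKOver :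
    (ObjectProperty.homMk (mapK A (pullback.fst f g)) : KOver A (pullback f g) ⟶ KOver A X) ≫
        (ObjectProperty.homMk (mapK A f) : KOver A X ⟶ KOver A Z) =
      (ObjectProperty.homMk (mapK A (pullback.snd f g)) : KOver A (pullback f g) ⟶ KOver A Y) ≫
        (ObjectProperty.homMk (mapK A g) : KOver A Y ⟶ KOver A Z) :=
  ObjectProperty.hom_ext _ (mapP_sq (A := A)
    (PullbackCone.mk (mapP A (pullback.fst f g)) (mapP A (pullback.snd f g)) (mapP_sq (A := A) (PullbackCone.mk (pullback.fst f g) (pullback.snd f g) pullback.condition))))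

omit [IsTopologicalGroup G₁] [HasFiniteLimits (BTemp G₁)]
  [HasColimitsOfShape WalkingParallelPair (BTemp G₁)] [PreservesLimitsOfShape WalkingCospan H]
  [PreservesLimitsOfShape (Discrete WalkingPair) H] in
/-- The lifting square commutes in `T₂[A₂]`. [cite: MochizukiSemiAnbd2006, Thm A.4 pp.82-86] -/
theorem commSq₂Over :
    k₂Over A Y ≫ (ObjectProperty.homMk (mapP A g) : POver A Y ⟶ POver A Z) =
      (ObjectProperty.homMk (mapK A g) : KOver A Y ⟶ KOver A Z) ≫ k₂Over A Z :=
  ObjectProperty.hom_ext _ (mapK_k₂ A g).symm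

omit [IsTopologicalGroup G₁] [HasFiniteLimits (BTemp G₁)]
  [HasColimitsOfShape WalkingParallelPair (BTemp G₁)] [PreservesLimitsOfShape (Discrete WalkingPair) H] in
/-- `H` carries `P(X ×_Z Y) = P X ×_{P Z} P Y` to a pullback. [cite: MochizukiSemiAnbd2006, Thm A.4 pp.82-86] -/
theorem nonempty_isLimitHP :
    Nonempty (IsLimit (PullbackCone.mk (HP A H (pullback.fst f g)) (HP A H (pullback.snd f g))
      (show HP A H (pullback.fst f g) ≫ HP A H f = HP A H (pullback.snd f g) ≫ HP A H g by
        rw [← H.map_comp, ← H.map_comp, commPOver]) :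
      PullbackCone (HP A H f) (HP A H g))) :=
  ⟨isLimitMapSq A H (commPOver A f g) (isLimit_P_pullback (A := A)
    (PullbackCone.mk (pullback.fst f g) (pullback.snd f g) pullback.condition) (pullbackIsPullback f g))⟩

omit [IsTopologicalGroup G₁] [HasFiniteLimits (BTemp G₁)]
  [HasColimitsOfShape WalkingParallelPair (BTemp G₁)] [PreservesLimitsOfShape (Discrete WalkingPair) H] in
/-- `H` carries `K(X ×_Z Y) = K X ×_{K Z} K Y` to a pullback. [cite: MochizukiSemiAnbd2006, Thm A.4 pp.82-86] -/
theorem nonempty_isLimitHK :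
    Nonempty (IsLimit (PullbackCone.mk (HK A H (pullback.fst f g)) (HK A H (pullback.snd f g))
      (show HK A H (pullback.fst f g) ≫ HK A H f = HK A H (pullback.snd f g) ≫ HK A H g by
        rw [← H.map_comp, ← H.map_comp, commKOver]) :
      PullbackCone (HK A H f) (HK A H g))) :=
  ⟨isLimitMapSq A H (commKOver A f g) (isLimit_K_pullback (A := A)
    (PullbackCone.mk (pullback.fst f g) (pullback.snd f g) pullback.condition) (pullbackIsPullback f g))⟩

omit [IsTopologicalGroup G₁] [HasFiniteLimits (BTemp G₁)]
  [HasColimitsOfShape WalkingParallelPair (BTemp G₁)] [PreservesLimitsOfShape (Discrete WalkingPair) H] in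
/-- `H` carries the lifting square `K Y = P Y ×_{P Z, k₂} K Z` to a pullback. [cite: MochizukiSemiAnbd2006, Thm A.4 pp.82-86] -/
theorem nonempty_isLimitHsq₂ :
    Nonempty (IsLimit (PullbackCone.mk (e₂ A H Y) (HK A H g)
      (show e₂ A H Y ≫ HP A H g = HK A H g ≫ e₂ A H Z by
        rw [← H.map_comp, ← H.map_comp, commSq₂Over]) :
      PullbackCone (HP A H g) (e₂ A H Z))) :=
  ⟨isLimitMapSq A H (commSq₂Over A g) (isLimit_sq₂ (A := A) g)⟩

omit [IsTopologicalGroup G₁] [HasFiniteLimits (BTemp G₁)]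
  [PreservesLimitsOfShape WalkingCospan H] [PreservesLimitsOfShape (Discrete WalkingPair) H] in
/-- The square of `ψ^*`-images of the pullback square commutes. [cite: MochizukiSemiAnbd2006, Thm A.4 pp.82-86] -/
theorem cechExt_sq :
    (cechExt A H).map (pullback.fst f g) ≫ (cechExt A H).map f =
      (cechExt A H).map (pullback.snd f g) ≫ (cechExt A H).map g := by
  rw [← Functor.map_comp, pullback.condition, Functor.map_comp]

omit [HasFiniteLimits (BTemp G₁)] in
/-- **`ψ^*` carries the pullback square `X ×_Z Y` to a pullback square** (points: injectivity by
`K(X ×_Z Y) = K X ×_{K Z} K Y` and the joint injectivity of `(H k₁, H k₂)`; surjectivity by the lifting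
square `K Y = P Y ×_{P Z, k₂} K Z`). [cite: MochizukiSemiAnbd2006, Thm A.4 pp.82-86] -/
theorem nonempty_isLimit_cechExt_pullbackCone :
    Nonempty (IsLimit (PullbackCone.mk ((cechExt A H).map (pullback.fst f g))
      ((cechExt A H).map (pullback.snd f g)) (cechExt_sq A H f g))) := by
  refine BTemp.isLimit_pullbackCone_of_bijective _ (fun w w' h₁ h₂ => ?_) (fun u v huv => ?_)
  · -- injectivity
    obtain ⟨p, rfl⟩ := π_surjective A H _ w
    obtain ⟨p', rfl⟩ := π_surjective A H _ w'
    change (((cechExt A H).map (pullback.fst f g)).hom.hom ((π A H _).hom.hom p) : _) =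
      ((cechExt A H).map (pullback.fst f g)).hom.hom ((π A H _).hom.hom p') at h₁
    change (((cechExt A H).map (pullback.snd f g)).hom.hom ((π A H _).hom.hom p) : _) =
      ((cechExt A H).map (pullback.snd f g)).hom.hom ((π A H _).hom.hom p') at h₂
    rw [cechExt_map_π_apply, cechExt_map_π_apply, π_apply_eq_iff] at h₁ h₂
    obtain ⟨wX, hX₁, hX₂⟩ := h₁
    obtain ⟨wY, hY₁, hY₂⟩ := h₂
    -- `wX`, `wY` agree in `H(K Z)`: compare their two projections
    have hZ : ((HK A H f).hom.hom wX : (H.obj (KOver A Z)).obj.V) = (HK A H g).hom.hom wY := by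
      apply KH_ext A H Z
      · rw [e₁_HK_apply, e₁_HK_apply, hX₁, hY₁, ← comp_apply', ← comp_apply', ← H.map_comp,
          ← H.map_comp]
        exact congrArg (fun φ => ((H.map φ).hom.hom p : (H.obj (POver A Z)).obj.V)) (commPOver A f g)
      · rw [e₂_HK_apply, e₂_HK_apply, hX₂, hY₂, ← comp_apply', ← comp_apply', ← H.map_comp,
          ← H.map_comp]
        exact congrArg (fun φ => ((H.map φ).hom.hom p' : (H.obj (POver A Z)).obj.V)) (commPOver A f g)
    obtain ⟨wW, hW₁, hW₂⟩ := BTemp.exists_point_of_isLimit_pullbackCone' (nonempty_isLimitHK A H f g).some wX wY hZ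
    apply (π_apply_eq_iff A H _).mpr
    refine ⟨wW, ?_, ?_⟩
    · apply BTemp.point_ext_of_isLimit_pullbackCone (nonempty_isLimitHP A H f g).some
      · change ((HP A H (pullback.fst f g)).hom.hom ((e₁ A H _).hom.hom wW) : _) =
          (HP A H (pullback.fst f g)).hom.hom p
        rw [← e₁_HK_apply, ← hX₁]
        exact congrArg (fun z => ((e₁ A H X).hom.hom z : (H.obj (POver A X)).obj.V)) hW₁
      · change ((HP A H (pullback.snd f g)).hom.hom ((e₁ A H _).hom.hom wW) : _) =
          (HP A H (pullback.snd f g)).hom.hom p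
        rw [← e₁_HK_apply, ← hY₁]
        exact congrArg (fun z => ((e₁ A H Y).hom.hom z : (H.obj (POver A Y)).obj.V)) hW₂
    · apply BTemp.point_ext_of_isLimit_pullbackCone (nonempty_isLimitHP A H f g).some
      · change ((HP A H (pullback.fst f g)).hom.hom ((e₂ A H _).hom.hom wW) : _) =
          (HP A H (pullback.fst f g)).hom.hom p'
        rw [← e₂_HK_apply, ← hX₂]
        exact congrArg (fun z => ((e₂ A H X).hom.hom z : (H.obj (POver A X)).obj.V)) hW₁
      · change ((HP A H (pullback.snd f g)).hom.hom ((e₂ A H _).hom.hom wW) : _) =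
          (HP A H (pullback.snd f g)).hom.hom p'
        rw [← e₂_HK_apply, ← hY₂]
        exact congrArg (fun z => ((e₂ A H Y).hom.hom z : (H.obj (POver A Y)).obj.V)) hW₂
  · -- surjectivity
    obtain ⟨x, rfl⟩ := π_surjective A H X u
    obtain ⟨y, rfl⟩ := π_surjective A H Y v
    change (((cechExt A H).map f).hom.hom ((π A H X).hom.hom x) : _) =
      ((cechExt A H).map g).hom.hom ((π A H Y).hom.hom y) at huv
    rw [cechExt_map_π_apply, cechExt_map_π_apply, π_apply_eq_iff] at huv
    obtain ⟨wZ, hZ₁, hZ₂⟩ := huv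
    -- lift `wZ` along `K Y = P Y ×_{P Z, k₂} K Z` to `v'` over `y`, and replace `y` by `y' := H k₁ v'`
    obtain ⟨v', hv'₁, hv'₂⟩ :=
      BTemp.exists_point_of_isLimit_pullbackCone' (nonempty_isLimitHsq₂ A H g).some y wZ hZ₂.symm
    let y' : (H.obj (POver A Y)).obj.V := (e₁ A H Y).hom.hom v'
    have hy' : ((π A H Y).hom.hom y' : _) = (π A H Y).hom.hom y :=
      (π_apply_eq_iff A H Y).mpr ⟨v', rfl, hv'₁⟩
    have hcompat : ((HP A H f).hom.hom x : (H.obj (POver A Z)).obj.V) = (HP A H g).hom.hom y' := by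
      change _ = (HP A H g).hom.hom ((e₁ A H Y).hom.hom v')
      rw [← e₁_HK_apply, ← hZ₁]
      exact (congrArg (fun z => ((e₁ A H Z).hom.hom z : (H.obj (POver A Z)).obj.V)) hv'₂).symm
    obtain ⟨p, hp₁, hp₂⟩ := BTemp.exists_point_of_isLimit_pullbackCone' (nonempty_isLimitHP A H f g).some x y' hcompat
    refine ⟨(π A H _).hom.hom p, ?_, ?_⟩
    · change (((cechExt A H).map (pullback.fst f g)).hom.hom ((π A H _).hom.hom p) : _) =
        (π A H X).hom.hom x
      rw [cechExt_map_π_apply]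
      exact congrArg (fun z => ((π A H X).hom.hom z : ((cechExt A H).obj X).obj.V)) hp₁
    · change (((cechExt A H).map (pullback.snd f g)).hom.hom ((π A H _).hom.hom p) : _) =
        (π A H Y).hom.hom y
      rw [cechExt_map_π_apply, ← hy']
      exact congrArg (fun z => ((π A H Y).hom.hom z : ((cechExt A H).obj Y).obj.V)) hp₂

omit [HasFiniteLimits (BTemp G₁)] in
/-- **`ψ^*` preserves the pullback of `f, g`.** [cite: MochizukiSemiAnbd2006, Thm A.4 pp.82-86] -/
theorem preservesLimit_cospan : PreservesLimit (cospan f g) (cechExt A H) :=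
  preservesLimit_of_preserves_limit_cone (pullbackIsPullback f g)
    ((isLimitMapConePullbackConeEquiv (cechExt A H) pullback.condition).symm
      (nonempty_isLimit_cechExt_pullbackCone A H f g).some)

end Pullback

/-! ### §6 `ψ^*` preserves finite limits -/

section FiniteLimits

variable [PreservesLimitsOfShape WalkingCospan H] [PreservesLimitsOfShape (Discrete WalkingPair) H]

/-- **The Čech extension `ψ^*` preserves finite limits** — the clause "`ψ` is a morphism of temperoids
[i.e., `ψ^*` preserves finite limits]" of Theorem A.4, for `H : T₂[A₂] ⥤ B^temp(Π₁)` preserving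
limits of cospan and binary-product shape and with `H(⊤ ⨯ A₂)` nonempty (Mathlib: terminal object +
pullbacks ⇒ all finite limits). [cite: MochizukiSemiAnbd2006, Thm A.4 pp.82-86] -/
theorem preservesFiniteLimits_cechExt (hne : Nonempty (H.obj (POver A (⊤_ BTemp G₂))).obj.V) :
    PreservesFiniteLimits (cechExt A H) := by
  haveI : PreservesLimit (Functor.empty.{0} (BTemp G₂)) (cechExt A H) := preservesLimit_empty A H hne
  haveI : PreservesLimitsOfShape (Discrete.{0} PEmpty) (cechExt A H) :=
    preservesLimitsOfShape_pempty_of_preservesTerminal (cechExt A H)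
  haveI : PreservesLimitsOfShape WalkingCospan (cechExt A H) :=
    ⟨fun {K} => by
      haveI := preservesLimit_cospan A H (K.map WalkingCospan.Hom.inl) (K.map WalkingCospan.Hom.inr)
      exact preservesLimit_of_iso_diagram (cechExt A H) (diagramIsoCospan K).symm⟩
  exact preservesFiniteLimits_of_preservesTerminal_and_pullbacks (cechExt A H)

end FiniteLimits

end CechSq

end Literature.AnabelianGeometry.SemiGraphs

end
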